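import Mathlib
import HarnessLib

/-!
# A Sierpiński-type set in `ℝ³`: not Lebesgue-measurable, yet finite on every sphere

`Literature/MeasureTheory/Lebesgue` (theorems only, everything PROVED). W. Sierpiński, *Sur un
problème concernant les ensembles mesurables superficiellement*, Fund. Math. 1 (1920) 112–115,
constructed a non-measurable subset of the plane meeting every line in at most two points; the
same Bernstein-type transfinite recursion gives, for any "thin" algebraic family of probes, a
non-measurable set that is finite on every member of the family (K. Ciesielski, *Set Theory for the
Working Mathematician*, CUP 1997, §6.1). This file proves the version for ROUND SPHERES (and
planes) of `ℝ³`: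

* `exists_sierpinskiSphereSet` —
  `∃ A ⊆ ℝ³, ¬ NullMeasurableSet A volume ∧ ∀ c ρ, (A ∩ sphere c ρ).Finite`.

Such a set is an "anti-Fubini" set: every sphere sees it in a null set although it has positive
outer measure; it is the generic witness against analytic statements that quantify over ALL
functions `f : ℝ³ → ℝ` and feed `f` to iterated Bochner integrals over spheres (the sphere
integrals are honest, the volume integral of `f` is the junk value `0`).

Construction (namespace `SierpinskiSphereSet`). Spheres and planes are zero sets of the linear
forms on the 5-dimensional quadric lift `x ↦ (‖x‖², x₀, x₁, x₂, 1)` (`lift5`, `Zset`). Recursion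
(`pts`, by `WellFounded.fix` along a well-order of order type `ord #Idx` on the `≤ 𝔠` compact sets
of positive volume, `Idx`, `mk_idx_le`): at stage `K` choose two new points `a_K, b_K ∈ K` keeping
all chosen points in general position (`GP`: any ≤ 5 of them have independent lifts), which is
possible because the forbidden set (`Bad`: < 𝔠 earlier points and the zero sets of < 𝔠 nonzero
quadrics, `piece_subset_Zset`) cannot cover `K` (`exists_mem_not_mem_bad`): probing with translated
MOMENT CURVES `t ↦ (t, y + t², z + t³)` (`curve`) — a nonzero quadric vanishes at ≤ 6 of their
points (`curvePoly_ne_zero`), whereas by the volume-preserving shear `(t,y,z) ↦ (t, y+t², z+t³)`,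
Fubini and the perfect set theorem some such curve carries `𝔠` points of `K`
(`exists_curve_section`). Then `A = {a_K}` and `B = {b_K} ⊆ Aᶜ` both meet every compact set of
positive volume, so `A` is not null-measurable (inner regularity), while a sphere contains ≤ 4
points in general position (`finite_inter_Zset`, `sphere_subset_Zset`). All [folklore].
-/

noncomputable section

open MeasureTheory Metric Set Filter Topology Cardinal Module Submodule
open scoped ENNReal Pointwise Cardinal

namespace Literature.MeasureTheory.Lebesgue

namespace SierpinskiSphereSet

local notation "V3" => EuclideanSpace ℝ (Fin 3)

/-- The quadric lift `x ↦ (‖x‖², x₀, x₁, x₂, 1) ∈ ℝ⁵`: spheres and planes of `ℝ³` are the zero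
sets of the linear forms `θ` on its image. [folklore] -/
def lift5 (x : V3) : Fin 5 → ℝ := ![‖x‖ ^ 2, x 0, x 1, x 2, 1]

/-- Evaluation `q_θ(x) = ∑ᵢ θᵢ · lift5(x)ᵢ = θ₀‖x‖² + θ₁x₀ + θ₂x₁ + θ₃x₂ + θ₄` of the spherical
quadric with coefficient vector `θ`. [folklore] -/
def qeval (θ : Fin 5 → ℝ) (x : V3) : ℝ := ∑ i, θ i * lift5 x i

/-- Zero set `{x | q_θ(x) = 0}` of the spherical quadric `θ` (for `θ ≠ 0`: a round sphere, a
plane, a point or `∅`). [folklore] -/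
def Zset (θ : Fin 5 → ℝ) : Set V3 := {x | qeval θ x = 0}

/-- General position for spherical quadrics: every finite subset with at most five points has
linearly independent lifts (any five chosen points impose independent conditions on the
5-dimensional space of quadrics). [folklore] -/
def GP (P : Set V3) : Prop :=
  ∀ S : Set V3, S ⊆ P → S.Finite → S.ncard ≤ 5 → LinearIndepOn ℝ lift5 S

/-- The piece of the forbidden set generated by a finite `S`: the points whose lift lies in the
span of the lifts of `S` (adding such a point to `S` would break general position).
[folklore] -/
def piece (S : Set V3) : Set V3 := {x | lift5 x ∈ span ℝ (lift5 '' S)}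

/-- The forbidden set at the next stage of the recursion: the points already chosen together
with all pieces generated by at most four of them. [folklore] -/
def Bad (P : Set V3) : Set V3 :=
  P ∪ ⋃ (S : Set V3) (_ : S ⊆ P ∧ S.Finite ∧ S.ncard ≤ 4), piece S

/-- The empty set is in general position. [folklore] -/
theorem gp_empty : GP ∅ := by
  intro S hS _ _
  rw [subset_empty_iff.1 hS]
  exact linearIndepOn_empty _ _

/-- Chosen points are forbidden. [folklore] -/
theorem subset_bad (P : Set V3) : P ⊆ Bad P := subset_union_left

/-- Extension step of the recursion: a point off the forbidden set keeps general position
(`LinearIndepOn.insert`). [folklore] -/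
theorem gp_insert {P : Set V3} (hP : GP P) {x : V3} (hx : x ∉ Bad P) : GP (insert x P) := by
  intro S hS hfin hcard
  by_cases hxS : x ∈ S
  · have hS' : S \ {x} ⊆ P := fun y hy => (hS hy.1).resolve_left (by simpa using hy.2)
    have hfin' : (S \ {x}).Finite := hfin.sdiff
    have hcard' : (S \ {x}).ncard ≤ 4 := by
      have := ncard_sdiff_singleton_add_one hxS hfin
      omega
    have hli : LinearIndepOn ℝ lift5 (S \ {x}) := hP _ hS' hfin' (hcard'.trans (by norm_num))
    have hnot : lift5 x ∉ span ℝ (lift5 '' (S \ {x})) := by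
      intro hmem
      apply hx
      refine Or.inr (mem_iUnion₂.2 ⟨S \ {x}, ⟨hS', hfin', hcard'⟩, hmem⟩)
    have := hli.insert hnot
    rwa [insert_sdiff_singleton, insert_eq_of_mem hxS] at this
  · exact hP S (fun y hy => (hS hy).resolve_left (fun h => hxS (h ▸ hy))) hfin hcard

/-- The linear form `v ↦ ∑ᵢ θᵢ vᵢ` on `ℝ⁵`. [folklore] -/
def dotL (θ : Fin 5 → ℝ) : (Fin 5 → ℝ) →ₗ[ℝ] ℝ where
  toFun v := ∑ i, θ i * v i
  map_add' v w := by simp only [Pi.add_apply, mul_add, Finset.sum_add_distrib]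
  map_smul' c v := by
    simp only [Pi.smul_apply, smul_eq_mul, RingHom.id_apply, Finset.mul_sum]
    refine Finset.sum_congr rfl fun i _ => by ring

/-- `dotL θ eⱼ = θⱼ`. [folklore] -/
theorem dotL_single (θ : Fin 5 → ℝ) (j : Fin 5) : dotL θ (Pi.single j 1) = θ j := by
  simp [dotL, Pi.single_apply]

/-- `dotL θ (lift5 x) = q_θ(x)`. [folklore] -/
theorem dotL_lift5 (θ : Fin 5 → ℝ) (x : V3) : dotL θ (lift5 x) = qeval θ x := rfl

/-- In general position a nonzero quadric vanishes at no more than four chosen points (five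
independent lifts span `ℝ⁵`, so a form vanishing on them is zero); in particular the zero
set meets the chosen set in a finite set. [folklore] -/
theorem finite_inter_Zset {P : Set V3} (hP : GP P) {θ : Fin 5 → ℝ} (hθ : θ ≠ 0) :
    (P ∩ Zset θ).Finite := by
  by_contra hinf
  obtain ⟨t, htsub, htcard⟩ := Set.Infinite.exists_subset_card_eq hinf 5
  have hli : LinearIndepOn ℝ lift5 (↑t : Set V3) :=
    hP _ (fun y hy => (htsub hy).1) t.finite_toSet (by simp [htcard])
  have hli' : LinearIndependent ℝ (fun y : (↑t : Set V3) => lift5 y) := hli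
  have hcard5 : Fintype.card (↑t : Set V3) = finrank ℝ (Fin 5 → ℝ) := by
    simp [htcard]
  have hspan := hli'.span_eq_top_of_card_eq_finrank' hcard5
  have hker : (⊤ : Submodule ℝ (Fin 5 → ℝ)) ≤ LinearMap.ker (dotL θ) := by
    rw [← hspan, span_le]
    rintro _ ⟨y, rfl⟩
    have hy : (y : V3) ∈ Zset θ := (htsub y.2).2
    simpa [Zset, dotL_lift5] using hy
  apply hθ
  funext j
  have : dotL θ (Pi.single j 1) = 0 := hker mem_top
  rwa [dotL_single] at this

/-- A piece generated by at most four points lies in the zero set of a NONZERO quadric (a proper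
subspace of `ℝ⁵` is annihilated by a nonzero form, `Submodule.exists_le_ker_of_lt_top`).
[folklore] -/
theorem piece_subset_Zset {S : Set V3} (hfin : S.Finite) (hcard : S.ncard ≤ 4) :
    ∃ θ : Fin 5 → ℝ, θ ≠ 0 ∧ piece S ⊆ Zset θ := by
  set W : Submodule ℝ (Fin 5 → ℝ) := span ℝ (lift5 '' S) with hW
  have hfinW : finrank ℝ W ≤ 4 := by
    have hfi : (lift5 '' S).Finite := hfin.image _
    have h1 : finrank ℝ W ≤ hfi.toFinset.card := by
      have := finrank_span_finset_le_card (R := ℝ) (M := Fin 5 → ℝ) hfi.toFinset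
      rwa [Set.Finite.coe_toFinset] at this
    have h2 : hfi.toFinset.card = (lift5 '' S).ncard := (ncard_eq_toFinset_card _ hfi).symm
    have h3 : (lift5 '' S).ncard ≤ S.ncard := ncard_image_le hfin
    omega
  have hlt : W < ⊤ := by
    refine lt_top_iff_ne_top.2 fun htop => ?_
    have : finrank ℝ W = 5 := by rw [htop, finrank_top]; simp
    omega
  obtain ⟨f, hf0, hle⟩ := Submodule.exists_le_ker_of_lt_top W hlt
  refine ⟨fun j => f (Pi.single j 1), ?_, ?_⟩
  · intro hzero
    apply hf0
    apply LinearMap.pi_ext'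
    intro j
    ext
    have := congr_fun hzero j
    simpa using this
  · intro x hx
    have hxk : lift5 x ∈ LinearMap.ker f := hle hx
    rw [LinearMap.mem_ker] at hxk
    show ∑ i, f (Pi.single i 1) * lift5 x i = 0
    have : f (lift5 x) = ∑ i, lift5 x i • f (Pi.single i 1) := by
      conv_lhs => rw [show lift5 x = ∑ i, lift5 x i • (Pi.single i (1 : ℝ) : Fin 5 → ℝ) from
        (by ext j; simp [Finset.sum_apply, Pi.single_apply])]
      simp [map_sum, map_smul]
    rw [this] at hxk
    simpa [smul_eq_mul, mul_comm] using hxk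


/-! ## Translated moment curves -/

/-- The shear vector `s(t) = (t², t³)`. [folklore] -/
def shearVec (t : ℝ) : Fin 2 → ℝ := ![t ^ 2, t ^ 3]

/-- `s` is continuous. [folklore] -/
theorem continuous_shearVec : Continuous shearVec := by
  refine continuous_pi fun i => ?_
  fin_cases i <;> simp [shearVec] <;> fun_prop

/-- The shear `Ψ(t, u) = (t, s(t) + u)` of `ℝ × ℝ²`, a volume-preserving homeomorphism (a skew
product of translations). [folklore] -/
def shear (p : ℝ × (Fin 2 → ℝ)) : ℝ × (Fin 2 → ℝ) := (p.1, shearVec p.1 + p.2)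

/-- `Ψ` is continuous. [folklore] -/
theorem continuous_shear : Continuous shear :=
  continuous_fst.prodMk ((continuous_shearVec.comp continuous_fst).add continuous_snd)

/-- `Ψ` preserves Lebesgue measure (`MeasurePreserving.skew_product` with the translation
invariance of Lebesgue measure on `ℝ²`). [folklore] -/
theorem measurePreserving_shear : MeasurePreserving shear volume volume := by
  have h := MeasurePreserving.skew_product (μa := (volume : Measure ℝ)) (μb := volume)
    (μc := (volume : Measure (Fin 2 → ℝ))) (μd := volume) (f := id) (MeasurePreserving.id volume)
    (g := fun t u => shearVec t + u)
    ((continuous_shearVec.comp continuous_fst).add continuous_snd).measurable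
    (Eventually.of_forall fun t => map_add_left_eq_self volume (shearVec t))
  exact h

/-- The chart `Γ(t, u) = (t, t² + u₀, t³ + u₁) ∈ ℝ³`; for fixed `u` it parametrises the
translated MOMENT CURVE through `(0, u₀, u₁)`. [folklore] -/
def curve (p : ℝ × (Fin 2 → ℝ)) : V3 :=
  WithLp.toLp 2 ((MeasurableEquiv.piFinSuccAbove (fun _ : Fin 3 => ℝ) 0).symm (shear p))

/-- The coordinate splitting `ℝ³ ≃ ℝ × ℝ²` is `Fin.cons` backwards. [folklore] -/
theorem piFinSuccAbove_symm_eq_cons (x : ℝ × (Fin 2 → ℝ)) :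
    (MeasurableEquiv.piFinSuccAbove (fun _ : Fin 3 => ℝ) 0).symm x = Fin.cons x.1 x.2 := by
  rw [← Fin.insertNth_zero']
  rfl

/-- `Γ(t, u)` in coordinates. [folklore] -/
theorem curve_eq_cons (p : ℝ × (Fin 2 → ℝ)) :
    curve p = WithLp.toLp 2 (Fin.cons p.1 (shearVec p.1 + p.2) : Fin 3 → ℝ) := by
  rw [curve, piFinSuccAbove_symm_eq_cons]
  rfl

/-- First coordinate of `Γ(t, u)` is `t`. [folklore] -/
theorem curve_apply_zero (p : ℝ × (Fin 2 → ℝ)) : curve p 0 = p.1 := by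
  rw [curve_eq_cons]
  rfl

/-- Second coordinate of `Γ(t, u)` is `t² + u₀`. [folklore] -/
theorem curve_apply_one (p : ℝ × (Fin 2 → ℝ)) : curve p 1 = p.1 ^ 2 + p.2 0 := by
  rw [curve_eq_cons]
  show (Fin.cons p.1 (shearVec p.1 + p.2) : Fin 3 → ℝ) (Fin.succ 0) = _
  rw [Fin.cons_succ]
  simp [shearVec]

/-- Third coordinate of `Γ(t, u)` is `t³ + u₁`. [folklore] -/
theorem curve_apply_two (p : ℝ × (Fin 2 → ℝ)) : curve p 2 = p.1 ^ 3 + p.2 1 := by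
  rw [curve_eq_cons]
  show (Fin.cons p.1 (shearVec p.1 + p.2) : Fin 3 → ℝ) (Fin.succ 1) = _
  rw [Fin.cons_succ]
  simp [shearVec]

/-- `Γ` is continuous. [folklore] -/
theorem continuous_curve : Continuous curve := by
  unfold curve
  refine (PiLp.continuous_toLp 2 _).comp ?_
  refine Continuous.comp ?_ continuous_shear
  refine continuous_pi fun i => ?_
  refine Fin.cases ?_ (fun j => ?_) i
  · simpa using continuous_fst
  · have : (fun a : ℝ × (Fin 2 → ℝ) =>
        (MeasurableEquiv.piFinSuccAbove (fun _ : Fin 3 => ℝ) 0).symm a (Fin.succ j)) =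
        fun a => a.2 j := by
      funext a; simp
    rw [this]
    exact (continuous_apply j).comp continuous_snd

/-- `Γ` preserves Lebesgue measure (composition of the shear, the coordinate splitting
`volume_preserving_piFinSuccAbove` and `PiLp.volume_preserving_toLp`). [folklore] -/
theorem measurePreserving_curve : MeasurePreserving curve volume volume := by
  unfold curve
  exact (PiLp.volume_preserving_toLp (Fin 3)).comp
    ((MeasurePreserving.symm _ (volume_preserving_piFinSuccAbove (fun _ : Fin 3 => ℝ) 0)).comp
      measurePreserving_shear)

/-- Each moment curve `t ↦ Γ(t, u)` is injective (first coordinate). [folklore] -/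
theorem curve_injective (u : Fin 2 → ℝ) : Function.Injective fun t : ℝ => curve (t, u) := by
  intro t₁ t₂ h
  have := congrArg (fun x : V3 => x 0) h
  simpa [curve_apply_zero] using this

open Polynomial in

/-- The quadric `q_θ` restricted to the moment curve through `(0, u)` is the polynomial `θ₀t⁶ +
θ₀t⁴ + (2u₁θ₀ + θ₃)t³ + ((1 + 2u₀)θ₀ + θ₂)t² + θ₁t + (θ₀(u₀² + u₁²) + θ₂u₀ + θ₃u₁ + θ₄)` of
degree `≤ 6`. [folklore] -/
def curvePoly (θ : Fin 5 → ℝ) (u : Fin 2 → ℝ) : ℝ[X] :=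
  C (θ 0) * X ^ 6 + C (θ 0) * X ^ 4 + C (2 * u 1 * θ 0 + θ 3) * X ^ 3 +
    C ((1 + 2 * u 0) * θ 0 + θ 2) * X ^ 2 + C (θ 1) * X ^ 1 +
    C (θ 0 * (u 0 ^ 2 + u 1 ^ 2) + θ 2 * u 0 + θ 3 * u 1 + θ 4) * X ^ 0

/-- `‖Γ(t, u)‖² = t² + (t² + u₀)² + (t³ + u₁)²`. [folklore] -/
theorem norm_sq_curve (t : ℝ) (u : Fin 2 → ℝ) :
    ‖curve (t, u)‖ ^ 2 = t ^ 2 + (t ^ 2 + u 0) ^ 2 + (t ^ 3 + u 1) ^ 2 := by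
  rw [EuclideanSpace.real_norm_sq_eq, Fin.sum_univ_three, curve_apply_zero, curve_apply_one,
    curve_apply_two]

/-- `curvePoly θ u` evaluates to `q_θ ∘ Γ(·, u)`. [folklore] -/
theorem curvePoly_eval (θ : Fin 5 → ℝ) (u : Fin 2 → ℝ) (t : ℝ) :
    (curvePoly θ u).eval t = qeval θ (curve (t, u)) := by
  simp only [curvePoly, qeval, lift5, Fin.sum_univ_five, Polynomial.eval_add, Polynomial.eval_mul,
    Polynomial.eval_C, Polynomial.eval_pow, Polynomial.eval_X, norm_sq_curve, curve_apply_one,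
    curve_apply_two]
  simp [curve_apply_zero]
  ring

/-- The coefficients of `curvePoly θ u`. [folklore] -/
theorem curvePoly_coeff (θ : Fin 5 → ℝ) (u : Fin 2 → ℝ) (n : ℕ) :
    (curvePoly θ u).coeff n =
      (if n = 6 then θ 0 else 0) + (if n = 4 then θ 0 else 0) +
        (if n = 3 then 2 * u 1 * θ 0 + θ 3 else 0) +
        (if n = 2 then (1 + 2 * u 0) * θ 0 + θ 2 else 0) + (if n = 1 then θ 1 else 0) +
        (if n = 0 then θ 0 * (u 0 ^ 2 + u 1 ^ 2) + θ 2 * u 0 + θ 3 * u 1 + θ 4 else 0) := by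
  simp only [curvePoly, Polynomial.coeff_add, Polynomial.coeff_C_mul_X_pow]

/-- For `θ ≠ 0` the restricted polynomial is nonzero (leading coefficient `θ₀`; if `θ₀ = 0` the
coefficients of `t³, t², t, 1` are `θ₃, θ₂, θ₁, θ₄`). This is why moment curves are used as
probes instead of lines: a line can lie inside a plane, a moment curve meets every sphere
and every plane in at most six points. [folklore] -/
theorem curvePoly_ne_zero {θ : Fin 5 → ℝ} (hθ : θ ≠ 0) (u : Fin 2 → ℝ) : curvePoly θ u ≠ 0 := by
  intro h0
  apply hθ
  have c6 := curvePoly_coeff θ u 6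
  have c3 := curvePoly_coeff θ u 3
  have c2 := curvePoly_coeff θ u 2
  have c1 := curvePoly_coeff θ u 1
  have c0 := curvePoly_coeff θ u 0
  rw [h0, Polynomial.coeff_zero] at c6 c3 c2 c1 c0
  norm_num at c6 c3 c2 c1 c0
  have h0' : θ 0 = 0 := by linarith
  have h1' : θ 1 = 0 := by linarith
  have h3' : θ 3 = 0 := by rw [h0'] at c3; linarith
  have h2' : θ 2 = 0 := by rw [h0'] at c2; linarith
  have h4' : θ 4 = 0 := by rw [h0', h2', h3'] at c0; linarith
  funext i
  fin_cases i <;> simp [h0', h1', h2', h3', h4']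

/-- A nonzero quadric vanishes at finitely many (≤ 6) points of each moment curve. [folklore] -/
theorem finite_curve_preimage_Zset {θ : Fin 5 → ℝ} (hθ : θ ≠ 0) (u : Fin 2 → ℝ) :
    {t : ℝ | curve (t, u) ∈ Zset θ}.Finite := by
  have h := Polynomial.finite_setOf_isRoot (curvePoly_ne_zero hθ u)
  refine h.subset fun t ht => ?_
  simp only [mem_setOf_eq, Polynomial.IsRoot.def, curvePoly_eval]
  exact ht

/-! ## Fubini along the curves: a curve carrying `𝔠` points of a non-null closed set -/

/-- FUBINI ALONG MOMENT CURVES: a closed set of positive volume meets some translated moment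
curve in a closed parameter set of positive length, hence (Cantor–Bendixson and the perfect
set theorem, `Perfect.exists_nat_bool_injection`) in at least `𝔠` points. [folklore] -/
theorem exists_curve_section {K : Set V3} (hK : IsClosed K) (hvol : volume K ≠ 0) :
    ∃ u : Fin 2 → ℝ, 𝔠 ≤ #{t : ℝ | curve (t, u) ∈ K} := by
  have hmeas : MeasurableSet (curve ⁻¹' K) := hK.measurableSet.preimage continuous_curve.measurable
  have hvol' : volume (curve ⁻¹' K) ≠ 0 := by
    rwa [measurePreserving_curve.measure_preimage hK.measurableSet.nullMeasurableSet]
  rw [Measure.volume_eq_prod, Measure.prod_apply_symm hmeas] at hvol'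
  have hex : ∃ u : Fin 2 → ℝ, volume ((fun t : ℝ => (t, u)) ⁻¹' (curve ⁻¹' K)) ≠ 0 := by
    by_contra h
    push Not at h
    apply hvol'
    simp [h]
  obtain ⟨u, hu⟩ := hex
  refine ⟨u, ?_⟩
  set T : Set ℝ := {t | curve (t, u) ∈ K} with hTdef
  have hT : (fun t : ℝ => (t, u)) ⁻¹' (curve ⁻¹' K) = T := rfl
  rw [hT] at hu
  have hTclosed : IsClosed T :=
    hK.preimage (continuous_curve.comp (continuous_id.prodMk continuous_const))
  have hTunc : ¬ T.Countable := fun hc => hu (hc.measure_zero _)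
  obtain ⟨D, hDperf, hDne, hDT⟩ :=
    exists_perfect_nonempty_of_isClosed_of_not_countable hTclosed hTunc
  obtain ⟨f, hfr, -, hfinj⟩ := hDperf.exists_nat_bool_injection hDne
  have hle : #(ℕ → Bool) ≤ #T := by
    refine Cardinal.mk_le_of_injective (f := fun b => (⟨f b, hDT (hfr ⟨b, rfl⟩)⟩ : T)) ?_
    intro b₁ b₂ h
    exact hfinj (congrArg Subtype.val h)
  have hc : #(ℕ → Bool) = 𝔠 := by
    rw [Cardinal.mk_arrow]; simp [Cardinal.two_power_aleph0]
  rwa [hc] at hle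

/-! ## Covering lemma: a non-null closed set is not covered by the bad set of `< 𝔠` points -/

/-- A type of cardinality `< 𝔠` has `< 𝔠` finite subsets. [folklore] -/
theorem mk_finset_lt_continuum {α : Type} (h : #α < 𝔠) : #(Finset α) < 𝔠 := by
  classical
  have h1 : #(Finset α) ≤ #(List α) := by
    refine Cardinal.mk_le_of_injective (f := Finset.toList) fun s t hst => ?_
    rw [← Finset.toList_toFinset s, hst, Finset.toList_toFinset]
  exact h1.trans_lt ((Cardinal.mk_list_le_max α).trans_lt (max_lt Cardinal.aleph0_lt_continuum h))

/-- COVERING LEMMA: a closed set of positive volume is not covered by the forbidden set of fewer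
than `𝔠` points — on the good moment curve the forbidden parameters number `< 𝔠` (each of
the `< 𝔠` pieces contributes finitely many, `finite_curve_preimage_Zset`,
`piece_subset_Zset`) while the curve carries `𝔠` points of the set (`exists_curve_section`).
[folklore] -/
theorem exists_mem_not_mem_bad {P : Set V3} (hP : #P < 𝔠) {K : Set V3}
    (hK : IsClosed K) (hvol : volume K ≠ 0) : ∃ x ∈ K, x ∉ Bad P := by
  classical
  obtain ⟨u, hu⟩ := exists_curve_section hK hvol
  set γ : ℝ → V3 := fun t => curve (t, u) with hγ
  have hγinj : Function.Injective γ := curve_injective u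
  let J : Type := {G : Finset P // G.card ≤ 4}
  let F : J → Set ℝ := fun G => γ ⁻¹' piece (Subtype.val '' (↑G.1 : Set P))
  have hcover : γ ⁻¹' Bad P ⊆ γ ⁻¹' P ∪ ⋃ G : J, F G := by
    intro t ht
    rcases ht with hP' | hU
    · exact Or.inl hP'
    · right
      obtain ⟨S, hS, hmem⟩ := mem_iUnion₂.1 hU
      obtain ⟨hSP, hSfin, hScard⟩ := hS
      let G : Finset P := hSfin.toFinset.subtype (· ∈ P)
      have hGS : Subtype.val '' (↑G : Set P) = S := by
        ext x
        constructor
        · rintro ⟨y, hy, rfl⟩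
          rw [Finset.mem_coe, Finset.mem_subtype] at hy
          exact hSfin.mem_toFinset.1 hy
        · intro hx
          refine ⟨⟨x, hSP hx⟩, ?_, rfl⟩
          rw [Finset.mem_coe, Finset.mem_subtype]
          exact hSfin.mem_toFinset.2 hx
      have hGcard : G.card ≤ 4 := by
        have : G.card = hSfin.toFinset.card := by
          rw [Finset.card_subtype, Finset.filter_true_of_mem]
          intro x hx
          exact hSP (hSfin.mem_toFinset.1 hx)
        rw [this, ← ncard_eq_toFinset_card S hSfin]
        exact hScard
      refine mem_iUnion.2 ⟨⟨G, hGcard⟩, ?_⟩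
      show γ t ∈ piece (Subtype.val '' (↑G : Set P))
      rw [hGS]
      exact hmem
  have hF : ∀ G : J, (F G).Finite := by
    intro G
    have hfin : (Subtype.val '' (↑G.1 : Set P)).Finite := (G.1.finite_toSet).image _
    have hcard : (Subtype.val '' (↑G.1 : Set P)).ncard ≤ 4 := by
      refine (ncard_image_le G.1.finite_toSet).trans ?_
      rw [ncard_coe_finset]
      exact G.2
    obtain ⟨θ, hθ, hsub⟩ := piece_subset_Zset hfin hcard
    exact (finite_curve_preimage_Zset hθ u).subset fun t ht => hsub ht
  -- cardinality of the bad parameters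
  have h1 : #(γ ⁻¹' P) ≤ #P := Cardinal.mk_preimage_of_injective _ _ hγinj
  have h2 : #(⋃ G : J, F G) ≤ #J * ℵ₀ := by
    refine (Cardinal.mk_iUnion_le F).trans ?_
    have hsup : ⨆ G : J, #(F G) ≤ ℵ₀ := ciSup_le' fun G => (hF G).lt_aleph0.le
    gcongr
  have hJ : #J < 𝔠 := (Cardinal.mk_subtype_le _).trans_lt (mk_finset_lt_continuum hP)
  have h3 : #J * ℵ₀ < 𝔠 :=
    Cardinal.mul_lt_of_lt Cardinal.aleph0_le_continuum hJ Cardinal.aleph0_lt_continuum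
  have hbad : #(γ ⁻¹' Bad P) < 𝔠 := by
    refine (Cardinal.mk_le_mk_of_subset hcover).trans_lt ?_
    refine (Cardinal.mk_union_le _ _).trans_lt ?_
    exact Cardinal.add_lt_of_lt Cardinal.aleph0_le_continuum (h1.trans_lt hP) (h2.trans_lt h3)
  -- a good parameter
  have hnot : ¬ ({t : ℝ | curve (t, u) ∈ K} ⊆ γ ⁻¹' Bad P) := fun hsub =>
    (lt_irrefl _) (((Cardinal.mk_le_mk_of_subset hsub).trans_lt hbad).trans_le hu)
  obtain ⟨t, htK, htbad⟩ := not_subset.1 hnot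
  exact ⟨γ t, htK, htbad⟩


/-! ## General position is inherited by directed unions -/

/-- General position (a finitary property) passes to directed unions along a linear order.
[folklore] -/
theorem gp_iUnion_of_monotone {κ : Type*} [LinearOrder κ] {P : κ → Set V3} (hmono : Monotone P)
    (hGP : ∀ k, GP (P k)) : GP (⋃ k, P k) := by
  classical
  intro S hS hfin hcard
  rcases S.eq_empty_or_nonempty with rfl | ⟨x₀, hx₀⟩
  · exact linearIndepOn_empty _ _
  · obtain ⟨k₀, -⟩ := mem_iUnion.1 (hS hx₀)
    let kf : V3 → κ := fun x => if h : x ∈ ⋃ k, P k then (mem_iUnion.1 h).choose else k₀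
    have hkf : ∀ x ∈ S, x ∈ P (kf x) := by
      intro x hx
      have h : x ∈ ⋃ k, P k := hS hx
      simp only [kf, dif_pos h]
      exact (mem_iUnion.1 h).choose_spec
    have hne : (hfin.toFinset.image kf).Nonempty := by
      refine ⟨kf x₀, Finset.mem_image_of_mem _ (hfin.mem_toFinset.2 hx₀)⟩
    set m := (hfin.toFinset.image kf).max' hne with hm
    have hsub : S ⊆ P m := by
      intro x hx
      have hle : kf x ≤ m := Finset.le_max' _ _ (Finset.mem_image_of_mem _ (hfin.mem_toFinset.2 hx))
      exact hmono hle (hkf x hx)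
    exact hGP m S hsub hfin hcard

/-! ## The transfinite construction -/

/-- A good pair of new points of `K` given the previously chosen set `P`: both in `K`, the first
off `Bad P`, the second off `Bad (insert a P)`. [folklore] -/
def GoodPair (K P : Set V3) (ab : V3 × V3) : Prop :=
  ab.1 ∈ K ∧ ab.2 ∈ K ∧ ab.1 ∉ Bad P ∧ ab.2 ∉ Bad (insert ab.1 P)

open Classical in

/-- A choice of a good pair (junk value `(0, 0)` if none exists; one always exists at the stages
of the recursion, `exists_goodPair`). [folklore] -/
def choosePair (K P : Set V3) : V3 × V3 :=
  if h : ∃ ab : V3 × V3, GoodPair K P ab then h.choose else (0, 0)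

/-- `choosePair` chooses a good pair when one exists. [folklore] -/
theorem choosePair_spec {K P : Set V3} (h : ∃ ab : V3 × V3, GoodPair K P ab) :
    GoodPair K P (choosePair K P) := by
  unfold choosePair
  rw [dif_pos h]
  exact h.choose_spec

/-- Inserting a point keeps the cardinality `< 𝔠`. [folklore] -/
theorem mk_insert_lt_continuum {P : Set V3} (hP : #P < 𝔠) (a : V3) :
    #(insert a P : Set V3) < 𝔠 := by
  rw [insert_eq]
  refine (Cardinal.mk_union_le _ _).trans_lt ?_
  refine Cardinal.add_lt_of_lt Cardinal.aleph0_le_continuum ?_ hP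
  rw [Cardinal.mk_singleton]
  exact Cardinal.one_lt_aleph0.trans Cardinal.aleph0_lt_continuum

/-- A closed set of positive volume contains a good pair relative to any `< 𝔠` previously chosen
points (covering lemma, twice). [folklore] -/
theorem exists_goodPair {K P : Set V3} (hK : IsClosed K) (hvol : volume K ≠ 0)
    (hP : #P < 𝔠) :
    ∃ ab : V3 × V3, GoodPair K P ab := by
  obtain ⟨a, haK, haBad⟩ := exists_mem_not_mem_bad hP hK hvol
  obtain ⟨b, hbK, hbBad⟩ := exists_mem_not_mem_bad (mk_insert_lt_continuum hP a) hK hvol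
  exact ⟨(a, b), haK, hbK, haBad, hbBad⟩

section Construction

variable {ι : Type} [LinearOrder ι] [WellFoundedLT ι]

/-- THE TRANSFINITE RECURSION (`WellFounded.fix` along a well-order of the index type): the pair
of points chosen at stage `i` is a good pair of `K i` relative to all points chosen at
earlier stages. [folklore] -/
def pts (K : ι → Set V3) : ι → V3 × V3 :=
  wellFounded_lt.fix fun i rec =>
    choosePair (K i) {x | ∃ (j : ι) (hj : j < i), x = (rec j hj).1 ∨ x = (rec j hj).2}

/-- Points chosen strictly before stage `i`. [folklore] -/
def Prev (K : ι → Set V3) (i : ι) : Set V3 :=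
  {x | ∃ (j : ι) (_ : j < i), x = (pts K j).1 ∨ x = (pts K j).2}

/-- Points chosen up to and including stage `i`. [folklore] -/
def Upto (K : ι → Set V3) (i : ι) : Set V3 :=
  {x | ∃ (j : ι) (_ : j ≤ i), x = (pts K j).1 ∨ x = (pts K j).2}

/-- Unfolding of the recursion (`WellFounded.fix_eq`). [folklore] -/
theorem pts_eq (K : ι → Set V3) (i : ι) : pts K i = choosePair (K i) (Prev K i) := by
  unfold pts
  rw [WellFounded.fix_eq]
  rfl

/-- `Upto` is monotone in the stage. [folklore] -/
theorem upto_mono (K : ι → Set V3) : Monotone (Upto K) := by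
  intro i i' hii' x hx
  obtain ⟨j, hj, hx⟩ := hx
  exact ⟨j, hj.trans hii', hx⟩

/-- `Prev i` is the directed union of the `Upto j`, `j < i`. [folklore] -/
theorem prev_eq_iUnion (K : ι → Set V3) (i : ι) : Prev K i = ⋃ j : Iio i, Upto K (j : ι) := by
  ext x
  simp only [Prev, Upto, mem_iUnion, mem_setOf_eq]
  constructor
  · rintro ⟨j, hj, hx⟩
    exact ⟨⟨j, hj⟩, j, le_rfl, hx⟩
  · rintro ⟨⟨j, hj⟩, j', hj', hx⟩
    exact ⟨j', lt_of_le_of_lt hj' hj, hx⟩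

/-- `Upto i = Prev i ∪ {aᵢ, bᵢ}`. [folklore] -/
theorem upto_eq_insert (K : ι → Set V3) (i : ι) :
    Upto K i = insert (pts K i).2 (insert (pts K i).1 (Prev K i)) := by
  ext x
  simp only [Upto, Prev, mem_insert_iff, mem_setOf_eq]
  constructor
  · rintro ⟨j, hj, hx⟩
    rcases hj.lt_or_eq with h | rfl
    · exact Or.inr (Or.inr ⟨j, h, hx⟩)
    · rcases hx with h | h
      · exact Or.inr (Or.inl h)
      · exact Or.inl h
  · rintro (h | h | ⟨j, hj, hx⟩)
    · exact ⟨i, le_rfl, Or.inr h⟩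
    · exact ⟨i, le_rfl, Or.inl h⟩
    · exact ⟨j, hj.le, hx⟩

/-- `Prev i ⊆ Upto i`. [folklore] -/
theorem prev_subset_upto (K : ι → Set V3) (i : ι) : Prev K i ⊆ Upto K i := by
  rw [upto_eq_insert]
  exact (subset_insert _ _).trans (subset_insert _ _)

variable {K : ι → Set V3}

/-- Fewer than `𝔠` points are chosen before any stage whose initial segment has cardinality `<
𝔠`. [folklore] -/
theorem mk_prev_lt (hseg : ∀ i : ι, #(Iio i) < 𝔠) (i : ι) : #(Prev K i) < 𝔠 := by
  have hsub : Prev K i ⊆ (fun j => (pts K j).1) '' Iio i ∪ (fun j => (pts K j).2) '' Iio i := by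
    rintro x ⟨j, hj, hx | hx⟩
    · exact Or.inl ⟨j, hj, hx.symm⟩
    · exact Or.inr ⟨j, hj, hx.symm⟩
  calc #(Prev K i) ≤ #(↥((fun j => (pts K j).1) '' Iio i ∪ (fun j => (pts K j).2) '' Iio i)) :=
        Cardinal.mk_le_mk_of_subset hsub
    _ ≤ #(↥((fun j => (pts K j).1) '' Iio i)) + #(↥((fun j => (pts K j).2) '' Iio i)) :=
        Cardinal.mk_union_le _ _
    _ ≤ #(Iio i) + #(Iio i) := add_le_add Cardinal.mk_image_le Cardinal.mk_image_le
    _ < 𝔠 := Cardinal.add_lt_of_lt Cardinal.aleph0_le_continuum (hseg i) (hseg i)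

/-- THE INVARIANT, by well-founded induction: at every stage the chosen points are in general
position and the stage's pair is good (exists by `exists_goodPair`, general position
propagates by `gp_insert` and `gp_iUnion_of_monotone`). [folklore] -/
theorem invariant (hK : ∀ i, IsCompact (K i) ∧ volume (K i) ≠ 0) (hseg : ∀ i : ι, #(Iio i) < 𝔠)
    (i : ι) : GP (Upto K i) ∧ GoodPair (K i) (Prev K i) (pts K i) := by
  refine wellFounded_lt.induction
    (C := fun i => GP (Upto K i) ∧ GoodPair (K i) (Prev K i) (pts K i)) i ?_
  intro i ih
  · have hGPprev : GP (Prev K i) := by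
      rw [prev_eq_iUnion]
      refine gp_iUnion_of_monotone (fun j j' hjj' => upto_mono K (show (j : ι) ≤ j' from hjj')) ?_
      intro j
      exact (ih j j.2).1
    have hgood : GoodPair (K i) (Prev K i) (pts K i) := by
      rw [pts_eq]
      exact choosePair_spec (exists_goodPair (hK i).1.isClosed (hK i).2 (mk_prev_lt hseg i))
    refine ⟨?_, hgood⟩
    rw [upto_eq_insert]
    exact gp_insert (gp_insert hGPprev hgood.2.2.1) hgood.2.2.2

/-- All chosen points together are in general position. [folklore] -/
theorem gp_iUnion_upto (hK : ∀ i, IsCompact (K i) ∧ volume (K i) ≠ 0)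
    (hseg : ∀ i : ι, #(Iio i) < 𝔠) : GP (⋃ i, Upto K i) :=
  gp_iUnion_of_monotone (upto_mono K) fun i => (invariant hK hseg i).1

/-- No first point equals a second point (each new point avoids all earlier points and the two
points of one stage differ): the two families `A = {aᵢ}` and `B = {bᵢ}` are disjoint.
[folklore] -/
theorem fst_ne_snd (hK : ∀ i, IsCompact (K i) ∧ volume (K i) ≠ 0) (hseg : ∀ i : ι, #(Iio i) < 𝔠)
    (i j : ι) : (pts K i).1 ≠ (pts K j).2 := by
  intro h
  rcases lt_trichotomy i j with hij | rfl | hji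
  · -- b_j avoids Prev j ∋ a_i
    have hb := (invariant hK hseg j).2.2.2.2
    apply hb
    refine subset_bad _ (mem_insert_of_mem _ ⟨i, hij, Or.inl h.symm⟩)
  · have hb := (invariant hK hseg i).2.2.2.2
    exact hb (subset_bad _ (by rw [← h]; exact mem_insert _ _))
  · -- a_i avoids Prev i ∋ b_j
    have ha := (invariant hK hseg i).2.2.2.1
    exact ha (subset_bad _ ⟨j, hji, Or.inr h⟩)

end Construction

/-! ## Assembly -/

/-- Index type of the recursion: the compact subsets of `ℝ³` of positive volume (a plain `def`,
so that it carries no order instance before the well-order of cardinality type `ord #Idx` is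
chosen). [folklore] -/
def Idx : Type := {K : Set V3 // IsCompact K ∧ volume K ≠ 0}

/-- There are at most `𝔠` compact sets of positive volume (a closed set is determined by the
basic open sets of a countable basis missing it). [folklore] -/
theorem mk_idx_le : #Idx ≤ 𝔠 := by
  obtain ⟨b, hbc, -, hb⟩ := TopologicalSpace.exists_countable_basis V3
  have hinj : Function.Injective fun i : Idx => {s : b | (s : Set V3) ⊆ (Subtype.val i)ᶜ} := by
    intro i j hij
    have hij' : ∀ s : b, (s : Set V3) ⊆ (Subtype.val i)ᶜ ↔ (s : Set V3) ⊆ (Subtype.val j)ᶜ :=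
      fun s => Set.ext_iff.1 hij s
    have key : ∀ U : Set V3, IsOpen U → U = ⋃₀ {s ∈ b | s ⊆ U} := fun U hU =>
      hb.open_eq_sUnion' hU
    have hc : (Subtype.val i)ᶜ = (Subtype.val j)ᶜ := by
      rw [key _ i.2.1.isClosed.isOpen_compl, key _ j.2.1.isClosed.isOpen_compl]
      congr 1
      ext s
      constructor
      · rintro ⟨hs, hsub⟩
        exact ⟨hs, (hij' ⟨s, hs⟩).1 hsub⟩
      · rintro ⟨hs, hsub⟩
        exact ⟨hs, (hij' ⟨s, hs⟩).2 hsub⟩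
    exact Subtype.ext (compl_injective hc)
  haveI : Countable b := hbc.to_subtype
  calc #Idx ≤ #(Set b) := Cardinal.mk_le_of_injective hinj
    _ = 2 ^ #b := Cardinal.mk_set
    _ ≤ 2 ^ ℵ₀ := Cardinal.power_le_power_left two_ne_zero Cardinal.mk_le_aleph0
    _ = 𝔠 := Cardinal.two_power_aleph0

/-- Lebesgue measure on `ℝ³` is inner regular (instance check). [folklore] -/
theorem innerRegular_volume_V3 : (volume : Measure V3).InnerRegular := inferInstance

/-- A round sphere `{‖x - c‖ = ρ}` (any `ρ`) lies in the zero set of the quadric `θ = (1, -2c₀,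
-2c₁, -2c₂, ‖c‖² - ρ²) ≠ 0`. [folklore] -/
theorem sphere_subset_Zset (c : V3) (ρ : ℝ) :
    ∃ θ : Fin 5 → ℝ, θ ≠ 0 ∧ Metric.sphere c ρ ⊆ Zset θ := by
  refine ⟨![1, -2 * c 0, -2 * c 1, -2 * c 2, ‖c‖ ^ 2 - ρ ^ 2], ?_, ?_⟩
  · intro h
    have := congr_fun h 0
    simp at this
  · intro x hx
    rw [Metric.mem_sphere, dist_eq_norm] at hx
    have h1 : ‖x - c‖ ^ 2 = ρ ^ 2 := by rw [hx]
    rw [EuclideanSpace.real_norm_sq_eq, Fin.sum_univ_three] at h1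
    simp only [PiLp.sub_apply] at h1
    simp only [Zset, qeval, lift5, mem_setOf_eq, Fin.sum_univ_five, EuclideanSpace.real_norm_sq_eq,
      Fin.sum_univ_three]
    simp
    nlinarith [h1]

/-- **Sierpiński-type sphere set.** There is a set `A ⊆ ℝ³` that is NOT Lebesgue-null-measurable
and yet meets every round sphere (of any centre and radius) in a finite set.
Bernstein–Sierpiński transfinite construction: `A = {aᵢ}` and its shadow `B = {bᵢ} ⊆ Aᶜ`
both meet every compact set of positive volume (so `A` is neither null nor co-null on any
such set, hence not null-measurable by inner regularity), and all chosen points are in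
general position for spherical quadrics (≤ 4 on any sphere or plane). Sierpiński 1920 (Fund.
Math. 1, 112–115: a non-measurable plane set meeting every line in two points); the sphere
version is the standard variant (e.g. Ciesielski, *Set Theory for the Working
Mathematician*, 1997, §6.1). [folklore] -/
theorem _root_.Literature.MeasureTheory.Lebesgue.exists_sierpinskiSphereSet :
    ∃ A : Set V3, ¬ NullMeasurableSet A volume ∧
      ∀ (c : V3) (ρ : ℝ), (A ∩ Metric.sphere c ρ).Finite := by
  obtain ⟨instLO, instWF, hord⟩ := Cardinal.exists_ord_eq_type_lt Idx
  letI : LinearOrder Idx := instLO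
  haveI : WellFoundedLT Idx := instWF
  have hseg : ∀ i : Idx, #(Iio i) < 𝔠 := fun i => (Cardinal.mk_Iio_lt i hord).trans_le mk_idx_le
  let K : Idx → Set V3 := fun i => i.1
  have hK : ∀ i, IsCompact (K i) ∧ volume (K i) ≠ 0 := fun i => i.2
  let A : Set V3 := range fun i => (pts K i).1
  let B : Set V3 := range fun i => (pts K i).2
  have hAB_sub : A ∪ B ⊆ ⋃ i, Upto K i := by
    rintro x (⟨i, rfl⟩ | ⟨i, rfl⟩)
    · exact mem_iUnion.2 ⟨i, i, le_rfl, Or.inl rfl⟩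
    · exact mem_iUnion.2 ⟨i, i, le_rfl, Or.inr rfl⟩
  have hGP : GP (A ∪ B) := fun S hS hfin hcard =>
    gp_iUnion_upto hK hseg S (hS.trans hAB_sub) hfin hcard
  have hmeetA : ∀ C : Set V3, IsCompact C → volume C ≠ 0 → (A ∩ C).Nonempty := fun C hC hv =>
    ⟨(pts K ⟨C, hC, hv⟩).1, ⟨_, rfl⟩, (invariant hK hseg ⟨C, hC, hv⟩).2.1⟩
  have hmeetB : ∀ C : Set V3, IsCompact C → volume C ≠ 0 → (B ∩ C).Nonempty := fun C hC hv =>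
    ⟨(pts K ⟨C, hC, hv⟩).2, ⟨_, rfl⟩, (invariant hK hseg ⟨C, hC, hv⟩).2.2.1⟩
  have hdisj : ∀ x, x ∈ A → x ∉ B := by
    rintro _ ⟨i, rfl⟩ ⟨j, hj⟩
    exact fst_ne_snd hK hseg i j hj.symm
  refine ⟨A, ?_, ?_⟩
  · intro hA
    obtain ⟨A', hA'sub, hA'meas, hA'eq⟩ := hA.exists_measurable_subset_ae_eq
    by_cases hzero : volume A' = 0
    · have hAnull : volume A = 0 := by rw [← measure_congr hA'eq]; exact hzero
      set N := toMeasurable volume A with hN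
      have hNnull : volume N = 0 := by rw [hN, measure_toMeasurable]; exact hAnull
      have hNc : volume Nᶜ ≠ 0 := by
        intro hc
        have huniv : volume (univ : Set V3) = 0 := by
          refine nonpos_iff_eq_zero.1 ?_
          calc volume (univ : Set V3) ≤ volume N + volume Nᶜ := measure_univ_le_add_compl N
            _ = 0 := by rw [hNnull, hc, add_zero]
        exact (isOpen_univ.measure_pos volume univ_nonempty).ne' huniv
      obtain ⟨C, hCsub, hCcomp, hCpos⟩ :=
        (measurableSet_toMeasurable volume A).compl.exists_lt_isCompact (pos_iff_ne_zero.2 hNc)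
      obtain ⟨x, hxA, hxC⟩ := hmeetA C hCcomp hCpos.ne'
      exact hCsub hxC (subset_toMeasurable volume A hxA)
    · obtain ⟨C, hCsub, hCcomp, hCpos⟩ := hA'meas.exists_lt_isCompact (pos_iff_ne_zero.2 hzero)
      obtain ⟨x, hxB, hxC⟩ := hmeetB C hCcomp hCpos.ne'
      exact hdisj x (hA'sub (hCsub hxC)) hxB
  · intro c ρ
    obtain ⟨θ, hθ, hsub⟩ := sphere_subset_Zset c ρ
    refine (finite_inter_Zset hGP hθ).subset ?_
    rintro x ⟨hxA, hxs⟩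
    exact ⟨Or.inl hxA, hsub hxs⟩

end SierpinskiSphereSet

end Literature.MeasureTheory.Lebesgue

end
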